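import Literature.MathematicalPhysics.QuantumLattice.TorusPairSusceptibility
import HarnessLib

/-!
# The regular (amplitude) pair susceptibility of a finite torus in a canonical sector

Definition request `defn-regularTorusPairSusceptibility` (route
`HubbardSuperconductivity/CooperSharpness`, card `cooper-coordinate-sharpness` D1, item
`stmt-HubbardSuperconductivity-12972`; wanted for the crux `RiccatiWindow` and the foreseen
`RiccatiClause` split of `SharpnessDichotomy`). Same data and conventions as
`torusPairSusceptibility` (`TorusPairSusceptibility.lean`): `K := H − μ̄ N̂` with
`μ̄ = pairChemicalPotential H N`, `E := E₀(N) − μ̄ N` (`E₀(M) = H.minEnergyOn (szSector M 0)`),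
transition vector `v := (A + Aᴴ) ψ`, EXCEPT that the coherent ground doublet is projected out of
the transition vector:
`regularTorusPairSusceptibility H A N ψ = staticSusceptibility K E ((1 − P) v)`,
`P = eigenProj K (E + pairGap H N)`.

Rationale (from the request). With the midpoint `μ̄` the ground states of `H` in BOTH adjacent
sectors `(N ± 2, S^z = 0)` sit at the `K`-eigenvalue `E + pairGap H N`
(`minEnergyOn_add_two_sub_eq_pairGap`, `minEnergyOn_sub_two_sub_eq_pairGap`; here
`pairShifted_mulVec_of_isGroundStateInSector_add_two` / `_sub_two`), so `P` fixes them
(`eigenProj_pairGap_mulVec_of_isGroundStateInSector_add_two` / `_sub_two`) and `1 − P` removes them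
from `v`. Their contribution `2 ‖P v‖² / pairGap H N`
(`torusPairSusceptibility_eq_regular_add_normSq_div`) — the weight of the order operator applied to
the ground state on the adjacent members of the tower of states (Horsch–von der Linden trial state
`Ô|GS⟩/‖Ô|GS⟩‖`; Tasaki 2019, §2.2 and §3.3 Thm. 3.1), over the tower spacing — is the singular,
coherent part of `χ = torusPairSusceptibility H A N ψ` in a pair-ordered phase; what is left is
the amplitude susceptibility the route's Riccati/RPA law is about. In the language of
Lin–Hirsch–Scalapino 1988, §II eq. (8)–(9): the canonical pair-field susceptibility with the
lowest `(N_e ± 2)`-particle intermediate states (excitation energy exactly `Δ`) omitted from the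
sum over intermediate states.

Two layers, as in `TorusPairSusceptibility.lean`: (1) generic,
`regularStaticSusceptibility K E E' v = staticSusceptibility K E ((1 − eigenProj K E') v)` — Kato's
partial-fraction sum `Σ_{λ ≠ E} (λ − E)⁻¹ ⟨v, P_λ v⟩` (Kato 1966, I-§5.3 (5.23), (5.32)) with the
`λ = E'` term also dropped (`regularStaticSusceptibility_eq_sum`), and
`χ = χ^reg + 2 ‖P_{E'} v‖² / (E' − E)` (`staticSusceptibility_eq_regular_add_normSq_div`);
(2) torus, `E' = E + pairGap H N`, `v = (A + Aᴴ)ψ`.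
API (as requested, all proved): unfolding (`_eq`, `_eq_static` = the displayed formula);
`_smul`; the spectral sum with the `E + pairGap` terms omitted (`_eq_sum`); `χ = χ^reg + coherent
part` (sum form and closed form); `χ^reg ≤ χ` under the spectral hypothesis of
`torusPairSusceptibility_nonneg` (`_le`) or under `0 ≤ pairGap H N` (`_le_of_pairGap_nonneg`);
`0 ≤ χ^reg` (`_nonneg`); `χ^reg = χ` when `E + pairGap` is not an eigenvalue met by `v`
(`_of_forall`, `_of_eigenProj_mulVec_eq_zero`).

NOT here (deliberately): the size of the removed part in a pair-ordered phase, or `χ_amp` in BCS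
theory — those are the route's claims, not literature. No named facts are introduced.

Mathlib / tree search: `lean search 'regularStatic|regularTorus|amplitude susc'` — nothing.
Reused: `staticSusceptibility(_eq_sum, _smul)`, `torusPairSusceptibility`, `pairChemicalPotential`,
`pairGap`, `star_dotProduct_mulVec`, `star_dotProduct_conj_diagonal_mulVec`,
`star_eigenvectorUnitary_mulVec_apply`, `Matrix.IsHermitian.cfc_mulVec_of_eigenvector`,
`eigenProj_mulVec_of_eigenvector`, `sub_smul_totalNumber_mulVec_of_isGroundStateInSector`
(`TorusPairSusceptibility`); `eigenProj`, `reducedResolvent`, `eigenProj_isHermitian`,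
`eigenProj_mul_eigenProj`, `continuousOn_spectrum_real` (`ClusterPairBosonCouplings`);
`Matrix.IsHermitian.cfc_eq_conj_diagonal` (`DuhamelTwoPoint`); Mathlib `mulVec_eigenvectorBasis`,
`cfc_mul`.

Design notes. The projection acts on the transition VECTOR, as requested; since `P` and `S_K(E)`
are functional calculi of the same `K` this equals dropping the `E'`-pole of the reduced resolvent
(`regularStaticSusceptibility_eq_re`). If `pairGap H N = 0` then `E' = E`, whose terms are already
absent from `χ` (reduced-resolvent convention `x / 0 = 0`), so `χ^reg = χ`
(`regularStaticSusceptibility_self`). If the adjacent ground multiplets are degenerate beyond the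
doublet the whole `E'`-eigenspace is removed (the displayed formula). Inherited junk: truncated
`N − 2` (`_sub_two` carries `2 ≤ N`), `minEnergyOn = 0` on an empty sector, values in `ℝ`.

Sources: T. Kato, *Perturbation theory for linear operators* (1966), I-§5.3 (5.23), (5.26)–(5.32)
[Kato1966]; H. Q. Lin, J. E. Hirsch, D. J. Scalapino, PRB **37** (1988) 7359, §II eq. (8)–(9)
[LinHirschScalapino1988]; D. J. Scalapino, Phys. Rep. **250** (1995) 329, §4 (`P_d`)
[Scalapino1995]; H. Tasaki, J. Stat. Phys. **174** (2019) 735, §2.2, §3.3 Thm. 3.1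
[Tasaki2019Tower].
-/

noncomputable section

namespace Literature.MathematicalPhysics.QuantumLattice

open Matrix

/-! ### Generic layer: the static susceptibility with one eigenspace projected out -/

section Static

variable {n : Type*} [Fintype n] [DecidableEq n]

/-- The **regular static susceptibility** of the level `E` of the matrix `K` in the transition
direction `v`, relative to the exceptional energy `E'`: the static susceptibility
`χ_K(E; ·) = 2 Re ⟨·, S_K(E) ·⟩` (`staticSusceptibility`; `S_K(E)` Kato's reduced resolvent) of the
transition vector with the `E'`-eigenspace of `K` projected out,
`χ^reg_K(E, E'; v) = χ_K(E; (1 − P_{E'}) v)`, `P_{E'} = eigenProj K E'` Kato's eigenprojection.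
For Hermitian `K`: Kato's partial-fraction sum `Σ_{λ ≠ E} (λ − E)⁻¹ ⟨v, P_λ v⟩` (Kato 1966, I-§5.3
(5.23), (5.32)) with the `λ = E'` term also dropped, `2 Σ_{m : λ_m ≠ E'} |⟨u_m, v⟩|² / (λ_m − E)`
(`regularStaticSusceptibility_eq_sum`). [cite: Kato1966, I-§5.3 (5.26)–(5.32)] -/
def regularStaticSusceptibility (K : Matrix n n ℂ) (E E' : ℝ) (v : n → ℂ) : ℝ :=
  staticSusceptibility K E ((1 - eigenProj K E') *ᵥ v)

/-- Unfolding lemma for `regularStaticSusceptibility`. [folklore] -/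
theorem regularStaticSusceptibility_def (K : Matrix n n ℂ) (E E' : ℝ) (v : n → ℂ) :
    regularStaticSusceptibility K E E' v = staticSusceptibility K E ((1 - eigenProj K E') *ᵥ v) :=
  rfl

/-- No transition vector, no response. [folklore] -/
@[simp] theorem regularStaticSusceptibility_zero_right (K : Matrix n n ℂ) (E E' : ℝ) :
    regularStaticSusceptibility K E E' 0 = 0 := by
  simp [regularStaticSusceptibility]

/-- The regular susceptibility is a quadratic form in the transition vector:
`χ^reg(c v) = ‖c‖² χ^reg(v)`. [folklore] -/
theorem regularStaticSusceptibility_smul (K : Matrix n n ℂ) (E E' : ℝ) (c : ℂ) (v : n → ℂ) :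
    regularStaticSusceptibility K E E' (c • v) = ‖c‖ ^ 2 * regularStaticSusceptibility K E E' v := by
  rw [regularStaticSusceptibility, mulVec_smul, staticSusceptibility_smul,
    regularStaticSusceptibility]

/-- If the `E'`-eigenprojection annihilates the transition vector, nothing is removed:
`P_{E'} v = 0 ⇒ χ^reg = χ` (no Hermiticity needed). [folklore] -/
theorem regularStaticSusceptibility_eq_of_eigenProj_mulVec_eq_zero {K : Matrix n n ℂ} {E' : ℝ}
    {v : n → ℂ} (h : eigenProj K E' *ᵥ v = 0) (E : ℝ) :
    regularStaticSusceptibility K E E' v = staticSusceptibility K E v := by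
  rw [regularStaticSusceptibility, sub_mulVec, one_mulVec, h, sub_zero]

/-- The eigenprojections and the reduced resolvent of one matrix commute (both are functional
calculi of `K`; Kato 1966, I-(5.28)–(5.32)). [cite: Kato1966, I-§5.3 (5.32)] -/
theorem eigenProj_mul_reducedResolvent_comm (K : Matrix n n ℂ) (E E' : ℝ) :
    eigenProj K E' * reducedResolvent K E = reducedResolvent K E * eigenProj K E' := by
  rw [reducedResolvent, eigenProj, ← cfc_mul _ _ K (continuousOn_spectrum_real K _)
    (continuousOn_spectrum_real K _), ← cfc_mul _ _ K (continuousOn_spectrum_real K _)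
    (continuousOn_spectrum_real K _)]
  congr 1
  ext x
  exact mul_comm _ _

/-- **Resolvent form.** `χ^reg_K(E, E'; v) = 2 Re ⟨v, S_K(E) (1 − P_{E'}) v⟩`: projecting the
transition vector is the same as dropping the `E'`-pole of the reduced resolvent, because
`1 − P_{E'}` is a Hermitian idempotent commuting with `S_K(E)`. [cite: Kato1966, I-§5.3 (5.32)] -/
theorem regularStaticSusceptibility_eq_re (K : Matrix n n ℂ) (E E' : ℝ) (v : n → ℂ) :
    regularStaticSusceptibility K E E' v =
      2 * (star v ⬝ᵥ (reducedResolvent K E *ᵥ ((1 - eigenProj K E') *ᵥ v))).re := by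
  have hQh : (1 - eigenProj K E')ᴴ = 1 - eigenProj K E' := by
    rw [conjTranspose_sub, conjTranspose_one, (eigenProj_isHermitian K E').eq]
  have hQQ : (1 - eigenProj K E') * (1 - eigenProj K E') = 1 - eigenProj K E' := by
    rw [mul_sub, sub_mul, one_mul, mul_one, sub_mul, one_mul, eigenProj_mul_eigenProj, sub_self,
      sub_zero]
  have hQS : (1 - eigenProj K E') * reducedResolvent K E =
      reducedResolvent K E * (1 - eigenProj K E') := by
    rw [sub_mul, one_mul, mul_sub, mul_one, eigenProj_mul_reducedResolvent_comm]
  have hmat : (1 - eigenProj K E') * reducedResolvent K E * (1 - eigenProj K E') =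
      reducedResolvent K E * (1 - eigenProj K E') := by
    rw [hQS, mul_assoc, hQQ]
  have h := star_dotProduct_mulVec (1 - eigenProj K E')ᴴ v
    (reducedResolvent K E *ᵥ ((1 - eigenProj K E') *ᵥ v))
  rw [conjTranspose_conjTranspose, hQh, mulVec_mulVec, mulVec_mulVec, hmat, ← mulVec_mulVec] at h
  rw [regularStaticSusceptibility, staticSusceptibility, ← h]

/-- **Eigen-coordinates of the projected transition vector**: `⟨u_i, (1 − P_{E'}) v⟩` is `0` if
`λ_i = E'` and `⟨u_i, v⟩` otherwise (Mathlib's orthonormal eigenbasis `(u_i, λ_i)` of the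
Hermitian `K`). [folklore] -/
theorem star_eigenvectorBasis_dotProduct_one_sub_eigenProj_mulVec {K : Matrix n n ℂ}
    (hK : K.IsHermitian) (E' : ℝ) (v : n → ℂ) (i : n) :
    star ⇑(hK.eigenvectorBasis i) ⬝ᵥ ((1 - eigenProj K E') *ᵥ v) =
      if hK.eigenvalues i = E' then 0 else star ⇑(hK.eigenvectorBasis i) ⬝ᵥ v := by
  have hu : K *ᵥ ⇑(hK.eigenvectorBasis i) =
      ((hK.eigenvalues i : ℝ) : ℂ) • ⇑(hK.eigenvectorBasis i) := by
    rw [hK.mulVec_eigenvectorBasis, RCLike.real_smul_eq_coe_smul (K := ℂ)]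
    rfl
  have hP : eigenProj K E' *ᵥ ⇑(hK.eigenvectorBasis i) =
      (((if hK.eigenvalues i = E' then (1 : ℝ) else 0 : ℝ)) : ℂ) • ⇑(hK.eigenvectorBasis i) := by
    rw [eigenProj, hK.cfc_mulVec_of_eigenvector _ hu]
  rw [sub_mulVec, one_mulVec, dotProduct_sub, star_dotProduct_mulVec (eigenProj K E'),
    (eigenProj_isHermitian K E').eq, hP, star_smul, smul_dotProduct]
  split_ifs with h
  · simp
  · simp

/-- **The regular susceptibility as a spectral sum with the `E'`-terms omitted**: for Hermitian
`K` with orthonormal eigenbasis `(u_m, λ_m)`,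
`χ^reg_K(E, E'; v) = 2 Σ_m [λ_m ≠ E'] |⟨u_m, v⟩|² / (λ_m − E)` (the terms with `λ_m = E` vanish
anyway by `x / 0 = 0`, the reduced-resolvent convention). [cite: Kato1966, II-§2.2 (2.35)] -/
theorem regularStaticSusceptibility_eq_sum {K : Matrix n n ℂ} (hK : K.IsHermitian) (E E' : ℝ)
    (v : n → ℂ) :
    regularStaticSusceptibility K E E' v =
      2 * ∑ i, if hK.eigenvalues i = E' then 0 else
        ‖star ⇑(hK.eigenvectorBasis i) ⬝ᵥ v‖ ^ 2 / (hK.eigenvalues i - E) := by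
  rw [regularStaticSusceptibility, staticSusceptibility_eq_sum hK]
  congr 1
  refine Finset.sum_congr rfl fun i _ => ?_
  rw [star_eigenvectorBasis_dotProduct_one_sub_eigenProj_mulVec hK]
  split_ifs <;> simp

/-- **Decomposition, sum form**: the full susceptibility is the regular one plus the removed
`E'`-terms, `χ = χ^reg + 2 Σ_{m : λ_m = E'} |⟨u_m, v⟩|² / (E' − E)`. [cite: Kato1966, I-§5.3 (5.32)] -/
theorem staticSusceptibility_eq_regular_add_sum {K : Matrix n n ℂ} (hK : K.IsHermitian)
    (E E' : ℝ) (v : n → ℂ) :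
    staticSusceptibility K E v = regularStaticSusceptibility K E E' v +
      2 * ∑ i, if hK.eigenvalues i = E' then
        ‖star ⇑(hK.eigenvectorBasis i) ⬝ᵥ v‖ ^ 2 / (E' - E) else 0 := by
  rw [staticSusceptibility_eq_sum hK, regularStaticSusceptibility_eq_sum hK, ← mul_add,
    ← Finset.sum_add_distrib]
  congr 1
  refine Finset.sum_congr rfl fun i _ => ?_
  split_ifs with h
  · rw [h, zero_add]
  · rw [add_zero]

/-- **The weight of the `E'`-eigenspace in `v`**: `‖P_{E'} v‖² = Σ_{m : λ_m = E'} |⟨u_m, v⟩|²`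
(Parseval in the eigenbasis; `P_{E'}` a Hermitian idempotent). [cite: Kato1966, I-§5.3 (5.26)] -/
theorem star_eigenProj_mulVec_dotProduct_self {K : Matrix n n ℂ} (hK : K.IsHermitian) (E' : ℝ)
    (v : n → ℂ) :
    star (eigenProj K E' *ᵥ v) ⬝ᵥ (eigenProj K E' *ᵥ v) =
      ((∑ i, if hK.eigenvalues i = E' then ‖star ⇑(hK.eigenvectorBasis i) ⬝ᵥ v‖ ^ 2 else 0 :
        ℝ) : ℂ) := by
  have h1 : star (eigenProj K E' *ᵥ v) ⬝ᵥ (eigenProj K E' *ᵥ v) =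
      star v ⬝ᵥ (eigenProj K E' *ᵥ v) := by
    have h := star_dotProduct_mulVec (eigenProj K E') v (eigenProj K E' *ᵥ v)
    rw [(eigenProj_isHermitian K E').eq, mulVec_mulVec, eigenProj_mul_eigenProj] at h
    exact h.symm
  rw [h1, eigenProj, hK.cfc_eq_conj_diagonal, star_dotProduct_conj_diagonal_mulVec,
    Complex.ofReal_sum]
  refine Finset.sum_congr rfl fun i _ => ?_
  rw [star_eigenvectorUnitary_mulVec_apply, Complex.star_def, Complex.conj_mul']
  split_ifs <;> push_cast <;> ring

/-- **Decomposition, closed form**: `χ_K(E; v) = χ^reg_K(E, E'; v) + 2 ‖P_{E'} v‖² / (E' − E)` —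
the removed part is the single pole of the level `E'` with its total weight in `v`.
[cite: Kato1966, I-§5.3 (5.32)] -/
theorem staticSusceptibility_eq_regular_add_normSq_div {K : Matrix n n ℂ} (hK : K.IsHermitian)
    (E E' : ℝ) (v : n → ℂ) :
    staticSusceptibility K E v = regularStaticSusceptibility K E E' v +
      2 * (star (eigenProj K E' *ᵥ v) ⬝ᵥ (eigenProj K E' *ᵥ v)).re / (E' - E) := by
  rw [staticSusceptibility_eq_regular_add_sum hK E E', star_eigenProj_mulVec_dotProduct_self hK,
    Complex.ofReal_re, mul_div_assoc, Finset.sum_div]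
  congr 2
  refine Finset.sum_congr rfl fun i _ => ?_
  split_ifs
  · rfl
  · rw [zero_div]

/-- **`χ^reg ≤ χ`.** If the transition vector only meets eigenvectors with eigenvalue `≥ E`
(the hypothesis of `staticSusceptibility_nonneg`), the removed `E'`-terms are `≥ 0`.
[folklore] -/
theorem regularStaticSusceptibility_le {K : Matrix n n ℂ} (hK : K.IsHermitian) {E : ℝ} (E' : ℝ)
    {v : n → ℂ} (h : ∀ i, E ≤ hK.eigenvalues i ∨ star ⇑(hK.eigenvectorBasis i) ⬝ᵥ v = 0) :
    regularStaticSusceptibility K E E' v ≤ staticSusceptibility K E v := by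
  rw [staticSusceptibility_eq_regular_add_sum hK E E']
  refine le_add_of_nonneg_right (mul_nonneg zero_le_two (Finset.sum_nonneg fun i _ => ?_))
  split_ifs with hi
  · rcases h i with h | h
    · exact div_nonneg (sq_nonneg _) (sub_nonneg.2 (hi ▸ h))
    · simp [h]
  · exact le_rfl

/-- **`χ^reg ≤ χ`** when the exceptional level lies above the reference level, `E ≤ E'`
(no hypothesis on `v`). [folklore] -/
theorem regularStaticSusceptibility_le_of_le {K : Matrix n n ℂ} (hK : K.IsHermitian) {E E' : ℝ}
    (hE : E ≤ E') (v : n → ℂ) :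
    regularStaticSusceptibility K E E' v ≤ staticSusceptibility K E v := by
  rw [staticSusceptibility_eq_regular_add_normSq_div hK E E',
    star_eigenProj_mulVec_dotProduct_self hK, Complex.ofReal_re]
  refine le_add_of_nonneg_right (div_nonneg (mul_nonneg zero_le_two
    (Finset.sum_nonneg fun i _ => ?_)) (sub_nonneg.2 hE))
  split_ifs
  · exact sq_nonneg _
  · exact le_rfl

/-- **Nonnegativity of `χ^reg`** under the hypothesis of `staticSusceptibility_nonneg`
(the transition vector only meets eigenvalues `≥ E`). [folklore] -/
theorem regularStaticSusceptibility_nonneg {K : Matrix n n ℂ} (hK : K.IsHermitian) {E : ℝ}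
    (E' : ℝ) {v : n → ℂ} (h : ∀ i, E ≤ hK.eigenvalues i ∨ star ⇑(hK.eigenvectorBasis i) ⬝ᵥ v = 0) :
    0 ≤ regularStaticSusceptibility K E E' v := by
  rw [regularStaticSusceptibility_eq_sum hK]
  refine mul_nonneg zero_le_two (Finset.sum_nonneg fun i _ => ?_)
  split_ifs
  · exact le_rfl
  · rcases h i with h | h
    · exact div_nonneg (sq_nonneg _) (sub_nonneg.2 h)
    · simp [h]

/-- **`χ^reg = χ` when `E'` is not an eigenvalue met by `v`**: if every eigenvector with
eigenvalue `E'` is orthogonal to `v`, nothing is removed. [folklore] -/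
theorem regularStaticSusceptibility_eq_of_forall {K : Matrix n n ℂ} (hK : K.IsHermitian) (E : ℝ)
    {E' : ℝ} {v : n → ℂ}
    (h : ∀ i, hK.eigenvalues i = E' → star ⇑(hK.eigenvectorBasis i) ⬝ᵥ v = 0) :
    regularStaticSusceptibility K E E' v = staticSusceptibility K E v := by
  rw [staticSusceptibility_eq_regular_add_sum hK E E']
  conv_lhs => rw [← add_zero (regularStaticSusceptibility K E E' v)]
  congr 1
  rw [eq_comm, mul_eq_zero]
  refine Or.inr (Finset.sum_eq_zero fun i _ => ?_)
  split_ifs with hi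
  · simp [h i hi]
  · rfl

/-- At `E' = E` nothing new is removed: the `E`-terms were already absent from `χ`
(reduced-resolvent convention), so `χ^reg_K(E, E; v) = χ_K(E; v)`. [folklore] -/
theorem regularStaticSusceptibility_self {K : Matrix n n ℂ} (hK : K.IsHermitian) (E : ℝ)
    (v : n → ℂ) : regularStaticSusceptibility K E E v = staticSusceptibility K E v := by
  rw [staticSusceptibility_eq_regular_add_sum hK E E, sub_self]
  simp

end Static

/-! ### Canonical bookkeeping: the adjacent-sector ground states sit at `E + pairGap` -/

section Hubbard

variable {Λ : Type*} [LinearOrder Λ] [Fintype Λ]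

/-- With the midpoint chemical potential `μ̄ = pairChemicalPotential H N`, a ground state `φ` of
`H` in the sector `(N+2, S^z = 0)` is an eigenvector of `K = H − μ̄ N̂` with eigenvalue
`E + pairGap H N`, `E = E₀(N) − μ̄ N` (Lin–Hirsch–Scalapino 1988, after eq. (9):
`E₀(N_e+2) − E₀(N_e) − 2μ = Δ`). [cite: LinHirschScalapino1988, §II eq. (9)] -/
theorem pairShifted_mulVec_of_isGroundStateInSector_add_two
    {H : Matrix (Finset (Orb Λ)) (Finset (Orb Λ)) ℂ} {N : ℕ} {φ : Fock (Orb Λ)}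
    (hφ : IsGroundStateInSector H (N + 2) 0 φ) :
    (H - (pairChemicalPotential H N : ℂ) • (totalNumber : Matrix (Finset (Orb Λ)) _ ℂ)) *ᵥ φ =
      ((H.minEnergyOn (szSector N 0) - pairChemicalPotential H N * N + pairGap H N : ℝ) : ℂ) •
        φ := by
  have hE : H.minEnergyOn (szSector (N + 2) 0) - pairChemicalPotential H N * ((N + 2 : ℕ) : ℝ) =
      H.minEnergyOn (szSector N 0) - pairChemicalPotential H N * N + pairGap H N := by
    have := minEnergyOn_add_two_sub_eq_pairGap H N
    push_cast
    linarith
  rw [sub_smul_totalNumber_mulVec_of_isGroundStateInSector hφ, hE]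

/-- Likewise for the sector `(N−2, S^z = 0)` when `2 ≤ N`: `K φ = (E + pairGap H N) φ`
(Lin–Hirsch–Scalapino 1988, after eq. (9): `E₀(N_e−2) − E₀(N_e) + 2μ = Δ`).
[cite: LinHirschScalapino1988, §II eq. (9)] -/
theorem pairShifted_mulVec_of_isGroundStateInSector_sub_two
    {H : Matrix (Finset (Orb Λ)) (Finset (Orb Λ)) ℂ} {N : ℕ} (hN : 2 ≤ N) {φ : Fock (Orb Λ)}
    (hφ : IsGroundStateInSector H (N - 2) 0 φ) :
    (H - (pairChemicalPotential H N : ℂ) • (totalNumber : Matrix (Finset (Orb Λ)) _ ℂ)) *ᵥ φ =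
      ((H.minEnergyOn (szSector N 0) - pairChemicalPotential H N * N + pairGap H N : ℝ) : ℂ) •
        φ := by
  have hE : H.minEnergyOn (szSector (N - 2) 0) - pairChemicalPotential H N * ((N - 2 : ℕ) : ℝ) =
      H.minEnergyOn (szSector N 0) - pairChemicalPotential H N * N + pairGap H N := by
    have := minEnergyOn_sub_two_sub_eq_pairGap H N
    push_cast [Nat.cast_sub hN]
    linarith
  rw [sub_smul_totalNumber_mulVec_of_isGroundStateInSector hφ, hE]

/-- Hence, for Hermitian `H`, the eigenprojection `P = eigenProj K (E + pairGap H N)` fixes every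
ground state of the `(N+2)`-sector … [cite: Kato1966, I-§5.3 (5.26)] -/
theorem eigenProj_pairGap_mulVec_of_isGroundStateInSector_add_two
    {H : Matrix (Finset (Orb Λ)) (Finset (Orb Λ)) ℂ} (hH : H.IsHermitian) {N : ℕ} {φ : Fock (Orb Λ)}
    (hφ : IsGroundStateInSector H (N + 2) 0 φ) :
    eigenProj (H - (pairChemicalPotential H N : ℂ) • totalNumber)
        (H.minEnergyOn (szSector N 0) - pairChemicalPotential H N * N + pairGap H N) *ᵥ φ = φ :=
  eigenProj_mulVec_of_eigenvector (isHermitian_sub_smul_totalNumber hH _)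
    (pairShifted_mulVec_of_isGroundStateInSector_add_two hφ)

/-- … and every ground state of the `(N−2)`-sector (`2 ≤ N`), so that `1 − P` removes the whole
coherent ground doublet from any transition vector. [cite: Kato1966, I-§5.3 (5.26)] -/
theorem eigenProj_pairGap_mulVec_of_isGroundStateInSector_sub_two
    {H : Matrix (Finset (Orb Λ)) (Finset (Orb Λ)) ℂ} (hH : H.IsHermitian) {N : ℕ} (hN : 2 ≤ N)
    {φ : Fock (Orb Λ)} (hφ : IsGroundStateInSector H (N - 2) 0 φ) :
    eigenProj (H - (pairChemicalPotential H N : ℂ) • totalNumber)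
        (H.minEnergyOn (szSector N 0) - pairChemicalPotential H N * N + pairGap H N) *ᵥ φ = φ :=
  eigenProj_mulVec_of_eigenvector (isHermitian_sub_smul_totalNumber hH _)
    (pairShifted_mulVec_of_isGroundStateInSector_sub_two hN hφ)

end Hubbard

/-! ### The regular pair susceptibility of the torus in a canonical sector -/

section Torus

variable {L : ℕ}

/-- The **regular (amplitude) zero-temperature pair susceptibility of the finite torus in a
canonical sector** (definition request `regularTorusPairSusceptibility`, route
`HubbardSuperconductivity/CooperSharpness`, card `cooper-coordinate-sharpness` D1). Same data and
conventions as `torusPairSusceptibility`: `K = H − μ̄ N̂`, `μ̄ = pairChemicalPotential H N` the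
midpoint pair chemical potential of Lin–Hirsch–Scalapino 1988, eq. (9), `E = E₀(N) − μ̄ N`,
transition vector `v = (A + Aᴴ) ψ`; but the coherent ground doublet is projected out of `v`:
`χ^reg_A(ψ) = staticSusceptibility K E ((1 − P) v)`, `P = eigenProj K (E + pairGap H N)` the
eigenprojection of `K` onto the level at which the ground states of `H` in BOTH adjacent sectors
`(N ± 2, S^z = 0)` sit (`pairShifted_mulVec_of_isGroundStateInSector_add_two` / `_sub_two`).
Equivalently (`regularTorusPairSusceptibility_eq_sum`)
`χ^reg_A(ψ) = 2 Σ_{m : E^K_m ≠ E + Δ} |⟨m, (A + Aᴴ)ψ⟩|² / (E^K_m − E)`: the sum over intermediate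
states of the canonical pair-field susceptibility of Lin–Hirsch–Scalapino 1988, eq. (8)–(9)
(`T = 0`, fixed `N`) with the lowest `(N_e ± 2)`-particle intermediate states — those at
excitation energy exactly `Δ = pairGap H N`, the adjacent members of the tower of states
generated by the order operator (Tasaki 2019, §3.3) — omitted; and
`χ_A(ψ) = χ^reg_A(ψ) + 2 ‖P (A + Aᴴ)ψ‖² / pairGap H N`
(`torusPairSusceptibility_eq_regular_add_normSq_div`).
[cite: LinHirschScalapino1988, §II eq. (8)–(9)] -/
def regularTorusPairSusceptibility
    (H A : Matrix (Finset (Orb (FermionTorus 2 L))) (Finset (Orb (FermionTorus 2 L))) ℂ) (N : ℕ)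
    (ψ : Fock (Orb (FermionTorus 2 L))) : ℝ :=
  regularStaticSusceptibility (H - (pairChemicalPotential H N : ℂ) • totalNumber)
    (H.minEnergyOn (szSector N 0) - pairChemicalPotential H N * N)
    (H.minEnergyOn (szSector N 0) - pairChemicalPotential H N * N + pairGap H N) ((A + Aᴴ) *ᵥ ψ)

variable (H A : Matrix (Finset (Orb (FermionTorus 2 L))) (Finset (Orb (FermionTorus 2 L))) ℂ)
  (N : ℕ) (ψ : Fock (Orb (FermionTorus 2 L)))

/-- Unfolding lemma: `χ^reg_A(ψ) = regularStaticSusceptibility K E (E + Δ) ((A + Aᴴ)ψ)`.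
[cite: LinHirschScalapino1988, §II eq. (8)–(9)] -/
theorem regularTorusPairSusceptibility_eq :
    regularTorusPairSusceptibility H A N ψ =
      regularStaticSusceptibility (H - (pairChemicalPotential H N : ℂ) • totalNumber)
        (H.minEnergyOn (szSector N 0) - pairChemicalPotential H N * N)
        (H.minEnergyOn (szSector N 0) - pairChemicalPotential H N * N + pairGap H N)
        ((A + Aᴴ) *ᵥ ψ) :=
  rfl

/-- **The displayed formula of the request**:
`χ^reg_A(ψ) = staticSusceptibility K E ((1 − eigenProj K (E + pairGap H N)) ((A + Aᴴ) ψ))`.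
[cite: LinHirschScalapino1988, §II eq. (8)–(9)] -/
theorem regularTorusPairSusceptibility_eq_static :
    regularTorusPairSusceptibility H A N ψ =
      staticSusceptibility (H - (pairChemicalPotential H N : ℂ) • totalNumber)
        (H.minEnergyOn (szSector N 0) - pairChemicalPotential H N * N)
        ((1 - eigenProj (H - (pairChemicalPotential H N : ℂ) • totalNumber)
            (H.minEnergyOn (szSector N 0) - pairChemicalPotential H N * N + pairGap H N)) *ᵥ
          ((A + Aᴴ) *ᵥ ψ)) :=
  rfl

/-- Phase and normalisation bookkeeping: `χ^reg_A(c ψ) = ‖c‖² χ^reg_A(ψ)`. [folklore] -/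
theorem regularTorusPairSusceptibility_smul (c : ℂ) :
    regularTorusPairSusceptibility H A N (c • ψ) =
      ‖c‖ ^ 2 * regularTorusPairSusceptibility H A N ψ := by
  rw [regularTorusPairSusceptibility, mulVec_smul, regularStaticSusceptibility_smul,
    regularTorusPairSusceptibility]

variable {H A N ψ}

/-- If the eigenprojection onto the level `E + pairGap H N` annihilates the transition vector,
nothing is removed: `P (A + Aᴴ)ψ = 0 ⇒ χ^reg_A(ψ) = χ_A(ψ)` (no Hermiticity needed). [folklore] -/
theorem regularTorusPairSusceptibility_eq_torusPairSusceptibility_of_eigenProj_mulVec_eq_zero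
    (h : eigenProj (H - (pairChemicalPotential H N : ℂ) • totalNumber)
      (H.minEnergyOn (szSector N 0) - pairChemicalPotential H N * N + pairGap H N) *ᵥ
        ((A + Aᴴ) *ᵥ ψ) = 0) :
    regularTorusPairSusceptibility H A N ψ = torusPairSusceptibility H A N ψ :=
  regularStaticSusceptibility_eq_of_eigenProj_mulVec_eq_zero h _

variable (A ψ)
  (hK : (H - (pairChemicalPotential H N : ℂ) •
    (totalNumber : Matrix (Finset (Orb (FermionTorus 2 L))) _ ℂ)).IsHermitian)

/-- **The defining spectral sum with the coherent terms omitted.** If `K = H − μ̄ N̂` is Hermitian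
(e.g. `H` Hermitian, `isHermitian_sub_smul_totalNumber`), then over Mathlib's orthonormal
eigenbasis `(u_m, E^K_m)` of `K`:
`χ^reg_A(ψ) = 2 Σ_m [E^K_m ≠ E + Δ] |⟨u_m, (A + Aᴴ)ψ⟩|² / (E^K_m − E)`, `E = E₀(N) − μ̄ N`,
`Δ = pairGap H N` (terms with `E^K_m = E` vanish by `x / 0 = 0`).
[cite: Kato1966, II-§2.2 (2.35)] -/
theorem regularTorusPairSusceptibility_eq_sum :
    regularTorusPairSusceptibility H A N ψ =
      2 * ∑ m, if hK.eigenvalues m =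
          H.minEnergyOn (szSector N 0) - pairChemicalPotential H N * N + pairGap H N then 0
        else ‖star ⇑(hK.eigenvectorBasis m) ⬝ᵥ ((A + Aᴴ) *ᵥ ψ)‖ ^ 2 /
          (hK.eigenvalues m - (H.minEnergyOn (szSector N 0) - pairChemicalPotential H N * N)) :=
  regularStaticSusceptibility_eq_sum hK _ _ _

/-- **`χ = χ^reg + coherent part`, sum form**: the removed terms are those with
`E^K_m = E + Δ`, each `|⟨u_m, (A + Aᴴ)ψ⟩|² / Δ`. [cite: Kato1966, I-§5.3 (5.32)] -/
theorem torusPairSusceptibility_eq_regular_add_sum :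
    torusPairSusceptibility H A N ψ = regularTorusPairSusceptibility H A N ψ +
      2 * ∑ m, if hK.eigenvalues m =
          H.minEnergyOn (szSector N 0) - pairChemicalPotential H N * N + pairGap H N then
        ‖star ⇑(hK.eigenvectorBasis m) ⬝ᵥ ((A + Aᴴ) *ᵥ ψ)‖ ^ 2 / pairGap H N else 0 := by
  rw [torusPairSusceptibility, regularTorusPairSusceptibility,
    staticSusceptibility_eq_regular_add_sum hK _
      (H.minEnergyOn (szSector N 0) - pairChemicalPotential H N * N + pairGap H N),
    add_sub_cancel_left]

include hK in
/-- **`χ = χ^reg + 2 ‖P (A + Aᴴ)ψ‖² / pairGap H N`**: the coherent (tower) part in closed form,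
`P` the eigenprojection of `K` onto the level `E + pairGap H N` of the adjacent-sector ground
states. [cite: Kato1966, I-§5.3 (5.32)] -/
theorem torusPairSusceptibility_eq_regular_add_normSq_div :
    torusPairSusceptibility H A N ψ = regularTorusPairSusceptibility H A N ψ +
      2 * (star (eigenProj (H - (pairChemicalPotential H N : ℂ) • totalNumber)
              (H.minEnergyOn (szSector N 0) - pairChemicalPotential H N * N + pairGap H N) *ᵥ
            ((A + Aᴴ) *ᵥ ψ)) ⬝ᵥ
          (eigenProj (H - (pairChemicalPotential H N : ℂ) • totalNumber)
              (H.minEnergyOn (szSector N 0) - pairChemicalPotential H N * N + pairGap H N) *ᵥ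
            ((A + Aᴴ) *ᵥ ψ))).re / pairGap H N := by
  rw [torusPairSusceptibility, regularTorusPairSusceptibility,
    staticSusceptibility_eq_regular_add_normSq_div hK _
      (H.minEnergyOn (szSector N 0) - pairChemicalPotential H N * N + pairGap H N),
    add_sub_cancel_left]

/-- **`χ^reg ≤ χ`.** If the transition vector `(A + Aᴴ)ψ` only meets eigenvectors of `K` with
`E^K_m ≥ E` (the hypothesis of `torusPairSusceptibility_nonneg`), the removed terms are `≥ 0`.
[folklore] -/
theorem regularTorusPairSusceptibility_le
    (h : ∀ m, H.minEnergyOn (szSector N 0) - pairChemicalPotential H N * N ≤ hK.eigenvalues m ∨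
      star ⇑(hK.eigenvectorBasis m) ⬝ᵥ ((A + Aᴴ) *ᵥ ψ) = 0) :
    regularTorusPairSusceptibility H A N ψ ≤ torusPairSusceptibility H A N ψ :=
  regularStaticSusceptibility_le hK _ h

include hK in
/-- **`χ^reg ≤ χ` when `0 ≤ pairGap H N`** (no hypothesis on the transition vector).
[folklore] -/
theorem regularTorusPairSusceptibility_le_of_pairGap_nonneg
    (hΔ : 0 ≤ pairGap H N) :
    regularTorusPairSusceptibility H A N ψ ≤ torusPairSusceptibility H A N ψ :=
  regularStaticSusceptibility_le_of_le hK (le_add_of_nonneg_right hΔ) _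

/-- **Nonnegativity of `χ^reg`** under the hypothesis of `torusPairSusceptibility_nonneg`.
[folklore] -/
theorem regularTorusPairSusceptibility_nonneg
    (h : ∀ m, H.minEnergyOn (szSector N 0) - pairChemicalPotential H N * N ≤ hK.eigenvalues m ∨
      star ⇑(hK.eigenvectorBasis m) ⬝ᵥ ((A + Aᴴ) *ᵥ ψ) = 0) :
    0 ≤ regularTorusPairSusceptibility H A N ψ :=
  regularStaticSusceptibility_nonneg hK _ h

/-- **`χ^reg = χ` when `E + pairGap H N` is not an eigenvalue met by the transition vector**
(every eigenvector of `K` at that level is orthogonal to `(A + Aᴴ)ψ`). [folklore] -/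
theorem regularTorusPairSusceptibility_eq_torusPairSusceptibility_of_forall
    (h : ∀ m, hK.eigenvalues m =
        H.minEnergyOn (szSector N 0) - pairChemicalPotential H N * N + pairGap H N →
      star ⇑(hK.eigenvectorBasis m) ⬝ᵥ ((A + Aᴴ) *ᵥ ψ) = 0) :
    regularTorusPairSusceptibility H A N ψ = torusPairSusceptibility H A N ψ :=
  regularStaticSusceptibility_eq_of_forall hK _ h

end Torus

end Literature.MathematicalPhysics.QuantumLattice
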